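import Summits.CriticalPhenomena.CardyFormulaZ2.Theorems.CardyFlipRussoVoronoiHubFromSmirnovDefs
import Literature.Analysis.Complex.InjectiveHolomorphic

/-!
# Stub `holo_uniform_bounds` of line `moebius-exact-delaunay-dilation-ward`
# (crux `VoronoiHubFromSmirnov`, stmt-CriticalPhenomena-6433)

THE UNIFORM `C²` PACKAGE OF A UNIVALENT MAP ON A COMPACT SET (brick of S3b, the conformal
transport of Voronoi crossings, I. Benjamini, O. Schramm, *Conformal invariance of Voronoi
percolation*, Comm. Math. Phys. 197 (1998) 75–107, §4).  The landed §4 lemmas of the line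
(`defect_implies_potentialDefect`, `isDelaunayPair_image_of_clearance`,
`moebius_osculation_circle`) are stated for a map `h` with derivative data `(h₁, h₂)` on a convex
set `B`: `HasDerivAt h (h₁ z) z`, `HasDerivAt h₁ (h₂ z) z`, `m ≤ ‖h₁ z‖ ≤ Λ`, `‖h₂ z‖ ≤ L`,
`‖h₂ z − h₂ w‖ ≤ L ‖z − w‖`, and the injectivity modulus `R₁ ≤ dist z w → η ≤ dist (h z) (h w)`.
This file supplies these hypotheses, with `h₁ = deriv h`, `h₂ = deriv (deriv h)` and constants
uniform over the closed balls `closedBall x r₁` (`x ∈ K`), for `h` holomorphic and injective on an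
open set `U` and a compact `K ⊆ U`.

Proof.
1. Thicken: `IsCompact.exists_cthickening_subset_open` gives `r > 0` with the compact closed
   thickening `K₂ = cthickening r K ⊆ U`; every `closedBall x r`, `x ∈ K`, lies in `K₂`
   (`closedBall_subset_cthickening`), and closed balls are convex.  We output `r₁ = r`.
2. Derivatives: on the open `U` the map `h` is analytic (`DifferentiableOn.analyticOnNhd`), hence
   so are `deriv h`, `deriv (deriv h)`, `deriv (deriv (deriv h))` (`AnalyticOnNhd.deriv`); this
   gives the two `HasDerivAt` clauses at every point of `K₂ ⊆ U` and continuity of all three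
   derivatives on `K₂`.
3. Bounds: continuity on the compact `K₂` (`IsCompact.exists_bound_of_continuousOn`) bounds
   `‖deriv h‖ ≤ Λ₀`, `‖deriv (deriv h)‖ ≤ L₀`, `‖deriv³ h‖ ≤ L₃`; since `deriv h ≠ 0` on `U`
   (tree: `Literature.Analysis.Complex.SCV.deriv_ne_zero_of_injOn`, Fritzsche–Grauert Thm. I.8.5)
   the reciprocal `‖deriv h‖⁻¹` is continuous on `K₂`, bounded by some `M`, whence
   `‖deriv h‖ ≥ m := (max M 1)⁻¹ > 0` (no case split on `K = ∅`).  Put `Λ = max Λ₀ m`,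
   `L = max (max L₀ L₃) 0`; the Lipschitz bound for `deriv (deriv h)` on each (convex) ball is the
   mean value inequality `Convex.norm_image_sub_le_of_norm_deriv_le` with the bound `L₃ ≤ L`.
4. Injectivity modulus: for `R₁ > 0` the set `S = (K₂ ×ˢ K₂) ∩ {R₁ ≤ dist p.1 p.2}` is compact,
   `p ↦ dist (h p.1) (h p.2)` is continuous and positive on it (injectivity on `U ⊇ K₂`), so its
   reciprocal is bounded by some `M'` and `η = (max M' 1)⁻¹` works.

No new definitions; Mathlib and the tree fact `deriv_ne_zero_of_injOn` only.
-/

noncomputable section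

namespace Summit.CriticalPhenomena.CardyFormulaZ2.Cruxes.VoronoiHubFromSmirnov.MoebiusExactDelaunayDilationWard

open scoped Topology
open Filter Set Metric

/-- Inverting a uniform bound on reciprocals: if `0 < d` and `‖d⁻¹‖ ≤ M` then `(max M 1)⁻¹ ≤ d`.
[folklore] -/
theorem hub_inv_max_le {d M : ℝ} (hd : 0 < d) (hM : ‖d⁻¹‖ ≤ M) : (max M 1)⁻¹ ≤ d := by
  have h1 : d⁻¹ ≤ max M 1 := by
    rw [Real.norm_of_nonneg (inv_nonneg.2 hd.le)] at hM
    exact hM.trans (le_max_left _ _)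
  exact inv_le_of_inv_le₀ hd h1

/-- A positive uniform lower bound for a continuous nowhere-vanishing function on a compact set,
WITHOUT a nonemptiness hypothesis: if `f` is continuous on the compact `s` and `f x ≠ 0` on `s`,
then `m ≤ ‖f x‖` on `s` for some `m > 0` (the reciprocal `‖f ·‖⁻¹` is continuous, hence bounded,
on `s`). [folklore] -/
theorem hub_exists_pos_le_norm {α E : Type*} [TopologicalSpace α] [NormedAddCommGroup E]
    {s : Set α} {f : α → E} (hs : IsCompact s) (hf : ContinuousOn f s) (h0 : ∀ x ∈ s, f x ≠ 0) :
    ∃ m : ℝ, 0 < m ∧ ∀ x ∈ s, m ≤ ‖f x‖ := by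
  have hinv : ContinuousOn (fun x => (‖f x‖)⁻¹) s :=
    hf.norm.inv₀ fun x hx => norm_ne_zero_iff.2 (h0 x hx)
  obtain ⟨M, hM⟩ := hs.exists_bound_of_continuousOn hinv
  exact ⟨(max M 1)⁻¹, inv_pos.2 (lt_of_lt_of_le one_pos (le_max_right _ _)), fun x hx =>
    hub_inv_max_le (norm_pos_iff.2 (h0 x hx)) (hM x hx)⟩

/-- UNIFORM INJECTIVITY MODULUS ON A COMPACT SET.  If `h` is continuous and injective on `U` and
`K₂ ⊆ U` is compact, then for every `R₁ > 0` there is `η > 0` with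
`R₁ ≤ dist z w → η ≤ dist (h z) (h w)` for all `z, w ∈ K₂`: the pairs `(z, w) ∈ K₂ × K₂` with
`R₁ ≤ dist z w` form a compact set on which `dist (h z) (h w)` is continuous and positive.
[folklore] -/
theorem hub_uniform_injOn {h : ℂ → ℂ} {U K₂ : Set ℂ} (hK₂ : IsCompact K₂) (hK₂U : K₂ ⊆ U)
    (hc : ContinuousOn h U) (hi : InjOn h U) {R₁ : ℝ} (hR₁ : 0 < R₁) :
    ∃ η : ℝ, 0 < η ∧ ∀ z ∈ K₂, ∀ w ∈ K₂, R₁ ≤ dist z w → η ≤ dist (h z) (h w) := by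
  set S : Set (ℂ × ℂ) := (K₂ ×ˢ K₂) ∩ {p : ℂ × ℂ | R₁ ≤ dist p.1 p.2} with hS
  have hSc : IsCompact S :=
    (hK₂.prod hK₂).inter_right (isClosed_le continuous_const continuous_dist)
  have hcK : ContinuousOn h K₂ := hc.mono hK₂U
  have hg : ContinuousOn (fun p : ℂ × ℂ => dist (h p.1) (h p.2)) (K₂ ×ˢ K₂) :=
    continuous_dist.comp_continuousOn
      ((hcK.comp continuousOn_fst fun p hp => hp.1).prodMk
        (hcK.comp continuousOn_snd fun p hp => hp.2))
  have hpos : ∀ p ∈ S, 0 < dist (h p.1) (h p.2) := by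
    rintro ⟨z, w⟩ ⟨⟨hz, hw⟩, hzw⟩
    have hzw' : R₁ ≤ dist z w := hzw
    have hne : z ≠ w := by
      rintro rfl
      rw [dist_self] at hzw'
      exact absurd hzw' (not_le.2 hR₁)
    exact dist_pos.2 (hi.ne (hK₂U hz) (hK₂U hw) hne)
  have hginv : ContinuousOn (fun p : ℂ × ℂ => (dist (h p.1) (h p.2))⁻¹) S :=
    (hg.mono inter_subset_left).inv₀ fun p hp => (hpos p hp).ne'
  obtain ⟨M, hM⟩ := hSc.exists_bound_of_continuousOn hginv
  refine ⟨(max M 1)⁻¹, inv_pos.2 (lt_of_lt_of_le one_pos (le_max_right _ _)), ?_⟩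
  intro z hz w hw hzw
  have hp : (z, w) ∈ S := ⟨⟨hz, hw⟩, hzw⟩
  exact hub_inv_max_le (hpos _ hp) (hM _ hp)

/-- **Uniform `C²` package of a univalent map on a compact set** (the hypotheses of the §4 lemmas
of Benjamini–Schramm 1998, uniformly on small balls).  Let `h` be complex-differentiable and
injective on the open set `U ⊆ ℂ` and `K ⊆ U` compact.  Then there are `r₁ > 0`, `L ≥ 0` and
`0 < m ≤ Λ` such that every closed ball `closedBall x r₁` (`x ∈ K`) lies in `U`, and on each of
them: `h` and `deriv h` have the derivatives `deriv h`, `deriv (deriv h)`; `m ≤ ‖deriv h‖ ≤ Λ`;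
`‖deriv (deriv h)‖ ≤ L` and `deriv (deriv h)` is `L`-Lipschitz; and for every `R₁ > 0` some
`η > 0` bounds `dist (h z) (h w)` from below whenever `R₁ ≤ dist z w`.  Proof: compact closed
thickening of `K` inside `U`, analyticity of `h` and its derivatives on `U`, continuity bounds on
the thickening, `deriv h ≠ 0` (`Literature.Analysis.Complex.SCV.deriv_ne_zero_of_injOn`), the
mean value inequality on convex balls, and compactness of the separated pairs. -/
theorem holo_uniform_bounds : ∀ (h : ℂ → ℂ) (U K : Set ℂ), IsOpen U → IsCompact K → K ⊆ U → DifferentiableOn ℂ h U → Set.InjOn h U → ∃ r₁ L m Λ : ℝ, 0 < r₁ ∧ 0 ≤ L ∧ 0 < m ∧ m ≤ Λ ∧ (∀ x ∈ K, Metric.closedBall x r₁ ⊆ U) ∧ (∀ x ∈ K, ∀ z ∈ Metric.closedBall x r₁, HasDerivAt h (deriv h z) z ∧ HasDerivAt (deriv h) (deriv (deriv h) z) z ∧ m ≤ ‖deriv h z‖ ∧ ‖deriv h z‖ ≤ Λ ∧ ‖deriv (deriv h) z‖ ≤ L) ∧ (∀ x ∈ K, ∀ z ∈ Metric.closedBall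 x r₁, ∀ w ∈ Metric.closedBall x r₁, ‖deriv (deriv h) z - deriv (deriv h) w‖ ≤ L * ‖z - w‖) ∧ (∀ R₁ : ℝ, 0 < R₁ → ∃ η : ℝ, 0 < η ∧ ∀ x ∈ K, ∀ z ∈ Metric.closedBall x r₁, ∀ w ∈ Metric.closedBall x r₁, R₁ ≤ dist z w → η ≤ dist (h z) (h w)) := by
  intro h U K hU hK hKU hd hi
  -- Step 1: a compact closed thickening of `K` inside `U`.
  obtain ⟨r, hr, hrU⟩ := hK.exists_cthickening_subset_open hU hKU
  set K₂ : Set ℂ := cthickening r K with hK₂def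
  have hK₂c : IsCompact K₂ := hK.cthickening
  have hK₂U : K₂ ⊆ U := hrU
  have hball : ∀ x ∈ K, closedBall x r ⊆ K₂ := fun x hx => closedBall_subset_cthickening hx r
  -- Step 2: `h` and all its derivatives are analytic on the open set `U`.
  have han : AnalyticOnNhd ℂ h U := hd.analyticOnNhd hU
  have han1 : AnalyticOnNhd ℂ (deriv h) U := han.deriv
  have han2 : AnalyticOnNhd ℂ (deriv (deriv h)) U := han1.deriv
  have han3 : AnalyticOnNhd ℂ (deriv (deriv (deriv h))) U := han2.deriv
  -- Step 3: uniform bounds on the compact `K₂`.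
  obtain ⟨Λ₀, hΛ₀⟩ := hK₂c.exists_bound_of_continuousOn (han1.continuousOn.mono hK₂U)
  obtain ⟨L₀, hL₀⟩ := hK₂c.exists_bound_of_continuousOn (han2.continuousOn.mono hK₂U)
  obtain ⟨L₃, hL₃⟩ := hK₂c.exists_bound_of_continuousOn (han3.continuousOn.mono hK₂U)
  have hne : ∀ z ∈ K₂, deriv h z ≠ 0 := fun z hz =>
    Literature.Analysis.Complex.SCV.deriv_ne_zero_of_injOn hd hU hi (hK₂U hz)
  obtain ⟨m, hm, hmle⟩ := hub_exists_pos_le_norm hK₂c (han1.continuousOn.mono hK₂U) hne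
  have hL₀L : L₀ ≤ max (max L₀ L₃) 0 := (le_max_left _ _).trans (le_max_left _ _)
  have hL₃L : L₃ ≤ max (max L₀ L₃) 0 := (le_max_right _ _).trans (le_max_left _ _)
  refine ⟨r, max (max L₀ L₃) 0, m, max Λ₀ m, hr, le_max_right _ _, hm, le_max_right _ _,
    ?_, ?_, ?_, ?_⟩
  · -- the balls lie in `U`
    exact fun x hx => (hball x hx).trans hK₂U
  · -- pointwise derivative data and bounds
    intro x hx z hz
    have hz₂ : z ∈ K₂ := hball x hx hz
    have hzU : z ∈ U := hK₂U hz₂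
    exact ⟨(han z hzU).differentiableAt.hasDerivAt, (han1 z hzU).differentiableAt.hasDerivAt,
      hmle z hz₂, (hΛ₀ z hz₂).trans (le_max_left _ _), (hL₀ z hz₂).trans hL₀L⟩
  · -- Lipschitz bound for `deriv (deriv h)` on each (convex) ball: mean value inequality
    intro x hx z hz w hw
    exact (convex_closedBall x r).norm_image_sub_le_of_norm_deriv_le
      (fun y hy => (han2 y (hK₂U (hball x hx hy))).differentiableAt)
      (fun y hy => (hL₃ y (hball x hx hy)).trans hL₃L) hw hz
  · -- uniform injectivity modulus
    intro R₁ hR₁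
    obtain ⟨η, hη, hηle⟩ := hub_uniform_injOn hK₂c hK₂U hd.continuousOn hi hR₁
    exact ⟨η, hη, fun x hx z hz w hw hzw => hηle z (hball x hx hz) w (hball x hx hw) hzw⟩

end Summit.CriticalPhenomena.CardyFormulaZ2.Cruxes.VoronoiHubFromSmirnov.MoebiusExactDelaunayDilationWard

end
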